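import Mathlib
import Summits.Ventures.PercRepro2.Defs
import Summits.Ventures.PercRepro2.Graph
import Summits.Ventures.PercRepro2.Induced
import Summits.Ventures.PercRepro2.VdBKahn
import Summits.Ventures.PercRepro2.ReimerVdBK

/-!
# The four regions of a 2-colouring and the differential form of (R-1.2)
(blind cell PercRepro2, mine-c g44; `conjectures/MINE-C.md` §53.0)

A 2-colouring of the edges is a configuration `ω` (world 1 = the open edges) together with its
complement `compl ω` (world 2).  With `K₁ = C_s(ω)` and `K₂ = C_s(compl ω)` the two clusters of the
root, the vertex set splits into the CORE `K₁ ∩ K₂`, the two PRIVATE regions `K₁ \ K₂` and `K₂ \ K₁`,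
and the region `(K₁ ∪ K₂)ᶜ` reached by neither world.  Every edge leaving a cluster has the other
world's colour; hence (i) an edge at a core vertex never leads outside `K₁ ∪ K₂`, and (ii) there is no
edge between the two private regions (`not_adj_only1_only2`) — the private regions are unions of
components of the graph induced on `(K₁ ∪ K₂) \ (K₁ ∩ K₂)`.

The DIFFERENTIAL FORM of the conjecture `(R-1.2)` (`RvdBK`): with `L = twoWorld A X B Y` and
`R = twoWorld (A ∪ B) (X ∩ Y) ∅ (X ∪ Y)`,
  `L \ R = {ω ∈ L | some vertex of B ∪ X lies in K₂ \ K₁}`,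
  `R \ L = {ω ∈ R | some vertex of B ∪ X lies in K₁ \ K₂}`,
and `RvdBK ↔ count (L \ R) ≤ count (R \ L)` (`rvdBK_iff_count_sdiff`): the conjecture says that the
marked set `B ∪ X` is moved from the world-2-private region to the world-1-private region by an
injection — the shape of the Hall / matching census of `MINE-C.md` §53.1.
-/

namespace Summit.Ventures.PercRepro2

namespace ReimerVdBK

open Classical

variable {V : Type*} {E : Type*} [Fintype E] [DecidableEq E] [Fintype V] [DecidableEq V]

/-! ## The two clusters of the root and the four regions -/

variable (ends : E → Sym2 V) (s : V)

/-- The world-1 cluster of the root: `K₁ = C_s(ω)`. -/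
def K₁ (ω : Config E) : Set V := cluster ends ω s

/-- The world-2 cluster of the root: `K₂ = C_s(compl ω)`. -/
def K₂ (ω : Config E) : Set V := cluster ends (compl ω) s

omit [Fintype E] [DecidableEq E] [Fintype V] [DecidableEq V] in
/-- Membership in the world-1 cluster. -/
@[simp] lemma mem_K₁ {ω : Config E} {v : V} : v ∈ K₁ ends s ω ↔ Conn ends ω s v := Iff.rfl

omit [Fintype E] [DecidableEq E] [Fintype V] [DecidableEq V] in
/-- Membership in the world-2 cluster. -/
@[simp] lemma mem_K₂ {ω : Config E} {v : V} : v ∈ K₂ ends s ω ↔ Conn ends (compl ω) s v := Iff.rfl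

omit [Fintype E] [DecidableEq E] [Fintype V] [DecidableEq V] in
/-- The root lies in both clusters. -/
lemma root_mem_K₁ (ω : Config E) : s ∈ K₁ ends s ω := conn_refl ends ω s

omit [Fintype E] [DecidableEq E] [Fintype V] [DecidableEq V] in
/-- The root lies in both clusters. -/
lemma root_mem_K₂ (ω : Config E) : s ∈ K₂ ends s ω := conn_refl ends (compl ω) s

omit [Fintype E] [DecidableEq E] [Fintype V] [DecidableEq V] in
/-- The world-2 cluster of `ω` is the world-1 cluster of `compl ω`. -/
lemma K₂_eq_K₁_compl (ω : Config E) : K₂ ends s ω = K₁ ends s (compl ω) := rfl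

omit [Fintype E] [DecidableEq E] [Fintype V] [DecidableEq V] in
/-- The world-1 cluster of `ω` is the world-2 cluster of `compl ω`. -/
lemma K₁_eq_K₂_compl (ω : Config E) : K₁ ends s ω = K₂ ends s (compl ω) := by
  simp only [K₂, compl_compl]; rfl

/-- The core `K₁ ∩ K₂`: the vertices reached by both worlds. -/
def core (ω : Config E) : Set V := K₁ ends s ω ∩ K₂ ends s ω

/-- The world-1-private region `K₁ \ K₂`. -/
def only1 (ω : Config E) : Set V := K₁ ends s ω \ K₂ ends s ω

/-- The world-2-private region `K₂ \ K₁`. -/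
def only2 (ω : Config E) : Set V := K₂ ends s ω \ K₁ ends s ω

/-- The region reached by neither world. -/
def neither (ω : Config E) : Set V := (K₁ ends s ω ∪ K₂ ends s ω)ᶜ

omit [Fintype E] [DecidableEq E] [Fintype V] [DecidableEq V] in
/-- The private regions are swapped by the colour swap. -/
lemma only2_eq_only1_compl (ω : Config E) : only2 ends s ω = only1 ends s (compl ω) := by
  unfold only2 only1 K₁ K₂
  rw [compl_compl]

omit [Fintype E] [DecidableEq E] [Fintype V] [DecidableEq V] in
/-- Membership in the world-1-private region. -/
@[simp] lemma mem_only1 {ω : Config E} {v : V} :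
    v ∈ only1 ends s ω ↔ v ∈ K₁ ends s ω ∧ v ∉ K₂ ends s ω := Iff.rfl

omit [Fintype E] [DecidableEq E] [Fintype V] [DecidableEq V] in
/-- Membership in the world-2-private region. -/
@[simp] lemma mem_only2 {ω : Config E} {v : V} :
    v ∈ only2 ends s ω ↔ v ∈ K₂ ends s ω ∧ v ∉ K₁ ends s ω := Iff.rfl

/-! ## Edges at the clusters: the forced colours -/

omit [Fintype E] [DecidableEq E] [Fintype V] [DecidableEq V] in
/-- An open edge at a vertex of `K₁` stays inside `K₁`. -/
lemma mem_K₁_of_open {ω : Config E} {u v : V} {e : E} (hu : u ∈ K₁ ends s ω) (he : ω e = true)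
    (hends : ends e = s(u, v)) : v ∈ K₁ ends s ω := by
  by_cases huv : u = v
  · subst huv; exact hu
  · exact mem_cluster_of_adj hu (openGraph_adj.2 ⟨huv, e, he, hends⟩)

omit [Fintype E] [DecidableEq E] [Fintype V] [DecidableEq V] in
/-- A closed edge at a vertex of `K₂` stays inside `K₂`. -/
lemma mem_K₂_of_closed {ω : Config E} {u v : V} {e : E} (hu : u ∈ K₂ ends s ω) (he : ω e = false)
    (hends : ends e = s(u, v)) : v ∈ K₂ ends s ω := by
  have he' : compl ω e = true := by simp [compl, he]
  exact mem_K₁_of_open ends s (ω := compl ω) hu he' hends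

omit [Fintype E] [DecidableEq E] [Fintype V] [DecidableEq V] in
/-- **Forced colour**: an edge leaving `K₁` is closed (world 2). -/
lemma closed_of_leaving_K₁ {ω : Config E} {u v : V} {e : E} (hu : u ∈ K₁ ends s ω)
    (hv : v ∉ K₁ ends s ω) (hends : ends e = s(u, v)) : ω e = false := by
  cases h : ω e with
  | false => rfl
  | true => exact absurd (mem_K₁_of_open ends s hu h hends) hv

omit [Fintype E] [DecidableEq E] [Fintype V] [DecidableEq V] in
/-- **Forced colour**: an edge leaving `K₂` is open (world 1). -/
lemma open_of_leaving_K₂ {ω : Config E} {u v : V} {e : E} (hu : u ∈ K₂ ends s ω)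
    (hv : v ∉ K₂ ends s ω) (hends : ends e = s(u, v)) : ω e = true := by
  cases h : ω e with
  | true => rfl
  | false => exact absurd (mem_K₂_of_closed ends s hu h hends) hv

omit [Fintype E] [DecidableEq E] [Fintype V] [DecidableEq V] in
/-- **No edge from the core to the outside**: an edge at a core vertex leads into `K₁ ∪ K₂`. -/
lemma mem_union_of_core_adj {ω : Config E} {u v : V} {e : E} (hu : u ∈ core ends s ω)
    (hends : ends e = s(u, v)) : v ∈ K₁ ends s ω ∪ K₂ ends s ω := by
  cases h : ω e with
  | true => exact Or.inl (mem_K₁_of_open ends s hu.1 h hends)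
  | false => exact Or.inr (mem_K₂_of_closed ends s hu.2 h hends)

omit [Fintype E] [DecidableEq E] [Fintype V] [DecidableEq V] in
/-- **No edge between the private regions**: a vertex of `K₁ \ K₂` and a vertex of `K₂ \ K₁` are never
joined by an edge (it would have to be open and closed at once). -/
lemma not_adj_only1_only2 {ω : Config E} {u v : V} (hu : u ∈ only1 ends s ω)
    (hv : v ∈ only2 ends s ω) (e : E) : ends e ≠ s(u, v) := by
  intro hends
  cases h : ω e with
  | true => exact hv.2 (mem_K₁_of_open ends s hu.1 h hends)
  | false => exact hu.2 (mem_K₂_of_closed ends s hv.1 h (by rw [hends, Sym2.eq_swap]))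

omit [Fintype E] [DecidableEq E] [Fintype V] [DecidableEq V] in
/-- An edge from the world-1-private region to the outside `(K₁ ∪ K₂)ᶜ` is closed. -/
lemma closed_of_only1_neither {ω : Config E} {u v : V} {e : E} (hu : u ∈ only1 ends s ω)
    (hv : v ∈ neither ends s ω) (hends : ends e = s(u, v)) : ω e = false :=
  closed_of_leaving_K₁ ends s hu.1 (fun h => hv (Or.inl h)) hends

omit [Fintype E] [DecidableEq E] [Fintype V] [DecidableEq V] in
/-- An edge from the world-2-private region to the outside `(K₁ ∪ K₂)ᶜ` is open. -/
lemma open_of_only2_neither {ω : Config E} {u v : V} {e : E} (hu : u ∈ only2 ends s ω)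
    (hv : v ∈ neither ends s ω) (hends : ends e = s(u, v)) : ω e = true :=
  open_of_leaving_K₂ ends s hu.1 (fun h => hv (Or.inr h)) hends

/-! ## The differential form of (R-1.2) -/

omit [Fintype V] in
/-- Counting splits along a second event. -/
lemma count_eq_count_inter_add_count_sdiff (A B : Set (Config E)) :
    count A = count (A ∩ B) + count (A \ B) := by
  unfold count
  rw [← Finset.sum_add_distrib]
  refine Finset.sum_congr rfl fun ω _ => ?_
  by_cases hA : ω ∈ A <;> by_cases hB : ω ∈ B <;> simp [hA, hB]

omit [Fintype V] in
/-- `count A ≤ count B ↔ count (A \ B) ≤ count (B \ A)`. -/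
lemma count_le_count_iff_sdiff (A B : Set (Config E)) :
    count A ≤ count B ↔ count (A \ B) ≤ count (B \ A) := by
  rw [count_eq_count_inter_add_count_sdiff A B, count_eq_count_inter_add_count_sdiff B A,
    Set.inter_comm B A]
  omega

omit [Fintype V] in
/-- **(R-1.2) in differential form**: `Φ(A, X; B, Y) ≤ Φ(A ∪ B, X ∩ Y; ∅, X ∪ Y)` iff the part of the
left event outside the right one is at most the part of the right event outside the left one. -/
theorem rvdBK_iff_count_sdiff (A X B Y : Finset V) :
    RvdBK ends s A X B Y ↔
      count (twoWorld ends s A X B Y \ twoWorld ends s (A ∪ B) (X ∩ Y) ∅ (X ∪ Y)) ≤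
        count (twoWorld ends s (A ∪ B) (X ∩ Y) ∅ (X ∪ Y) \ twoWorld ends s A X B Y) := by
  unfold RvdBK reimerCount
  exact count_le_count_iff_sdiff _ _

omit [Fintype E] [DecidableEq E] [Fintype V] [DecidableEq V] in
/-- Membership in the two-world event, in terms of the clusters. -/
lemma mem_twoWorld_iff {A X B Y : Finset V} {ω : Config E} :
    ω ∈ twoWorld ends s A X B Y ↔
      (∀ a ∈ A, a ∈ K₁ ends s ω) ∧ (∀ x ∈ X, x ∉ K₁ ends s ω) ∧
        (∀ b ∈ B, b ∈ K₂ ends s ω) ∧ (∀ y ∈ Y, y ∉ K₂ ends s ω) := by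
  simp only [twoWorld, Set.mem_inter_iff, mem_bar, connAll, avoidAll, Set.mem_setOf_eq, mem_K₁,
    mem_K₂]
  tauto

omit [Fintype E] [DecidableEq E] [Fintype V] in
/-- **The left event outside the right one**: `ω ∈ L \ R` iff `ω ∈ L` and some vertex of `B ∪ X`
lies in the world-2-private region `K₂ \ K₁`. -/
theorem mem_sdiff_left_iff {A X B Y : Finset V} {ω : Config E} :
    ω ∈ twoWorld ends s A X B Y \ twoWorld ends s (A ∪ B) (X ∩ Y) ∅ (X ∪ Y) ↔
      ω ∈ twoWorld ends s A X B Y ∧ ∃ v ∈ B ∪ X, v ∈ only2 ends s ω := by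
  rw [Set.mem_sdiff]
  constructor
  · rintro ⟨hL, hR⟩
    refine ⟨hL, ?_⟩
    rw [mem_twoWorld_iff] at hL hR
    obtain ⟨hA, hX, hB, hY⟩ := hL
    by_contra hcon
    apply hR
    refine ⟨?_, ?_, ?_, ?_⟩
    · intro a ha
      rcases Finset.mem_union.1 ha with ha | ha
      · exact hA a ha
      · by_contra h1
        exact hcon ⟨a, Finset.mem_union_left X ha, (mem_only2 ends s).2 ⟨hB a ha, h1⟩⟩
    · intro x hx
      exact hX x (Finset.mem_inter.1 hx).1
    · intro b hb
      exact absurd hb (Finset.notMem_empty b)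
    · intro y hy
      rcases Finset.mem_union.1 hy with hy | hy
      · intro h2
        exact hcon ⟨y, Finset.mem_union_right B hy, (mem_only2 ends s).2 ⟨h2, hX y hy⟩⟩
      · exact hY y hy
  · rintro ⟨hL, v, hv, hvo⟩
    obtain ⟨hv2, hv1⟩ := (mem_only2 ends s).1 hvo
    refine ⟨hL, fun hR => ?_⟩
    rw [mem_twoWorld_iff] at hR
    rcases Finset.mem_union.1 hv with hv | hv
    · exact hv1 (hR.1 v (Finset.mem_union_right A hv))
    · exact hR.2.2.2 v (Finset.mem_union_left Y hv) hv2

omit [Fintype E] [DecidableEq E] [Fintype V] in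
/-- **The right event outside the left one**: `ω ∈ R \ L` iff `ω ∈ R` and some vertex of `B ∪ X`
lies in the world-1-private region `K₁ \ K₂`. -/
theorem mem_sdiff_right_iff {A X B Y : Finset V} {ω : Config E} :
    ω ∈ twoWorld ends s (A ∪ B) (X ∩ Y) ∅ (X ∪ Y) \ twoWorld ends s A X B Y ↔
      ω ∈ twoWorld ends s (A ∪ B) (X ∩ Y) ∅ (X ∪ Y) ∧ ∃ v ∈ B ∪ X, v ∈ only1 ends s ω := by
  rw [Set.mem_sdiff]
  constructor
  · rintro ⟨hR, hL⟩
    refine ⟨hR, ?_⟩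
    rw [mem_twoWorld_iff] at hL hR
    obtain ⟨hQ, hZ, -, hW⟩ := hR
    by_contra hcon
    apply hL
    refine ⟨?_, ?_, ?_, ?_⟩
    · intro a ha
      exact hQ a (Finset.mem_union_left B ha)
    · intro x hx h1
      exact hcon ⟨x, Finset.mem_union_right B hx, (mem_only1 ends s).2 ⟨h1, hW x (Finset.mem_union_left Y hx)⟩⟩
    · intro b hb
      by_contra h2
      exact hcon ⟨b, Finset.mem_union_left X hb, (mem_only1 ends s).2 ⟨hQ b (Finset.mem_union_right A hb), h2⟩⟩
    · intro y hy
      exact hW y (Finset.mem_union_right X hy)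
  · rintro ⟨hR, v, hv, hvo⟩
    obtain ⟨hv1, hv2⟩ := (mem_only1 ends s).1 hvo
    refine ⟨hR, fun hL => ?_⟩
    rw [mem_twoWorld_iff] at hL
    rcases Finset.mem_union.1 hv with hv | hv
    · exact hv2 (hL.2.2.1 v hv)
    · exact hL.2.1 v hv hv1

end ReimerVdBK

end Summit.Ventures.PercRepro2
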